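import Summits.Ventures.DiscreteObjects.Hadamard.QRBlocks167

/-!
# Hadamard 668 census — the row-sum grammar of Goethals–Seidel quadruples over `ZMod 167`

Framing: lottery ticket; floor = certified bounds/negative ranges.

Cell pub-namedobj (venture DiscreteObjects), target (H).  For four `±1` sequences `a, b, c, d` on `ZMod v` with
`PAF_a + PAF_b + PAF_c + PAF_d = 0` at every non-zero shift (a Goethals–Seidel quadruple; Williamson and propus
quadruples are special cases) the PSD identity at frequency `0` reads `(Σa)² + (Σb)² + (Σc)² + (Σd)² = 4v`
(`gs_rowsum_sq`), and each row sum is odd when `v` is odd (`rowsum_odd`).  At `v = 167` this is the parameter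
GRAMMAR of the census (`668` as a sum of four odd squares: the 10 types enumerated exactly in TABLE-H / PLAN-H §2),
and it empties the degenerate coincidence sub-families by arithmetic alone: two pairs of equal blocks
(`no_gs167_pairs_equal`: `x² + y² = 334` is impossible for odd `x, y`, mod 8) and three equal blocks
(`no_gs167_three_equal`: `3x² + y² = 668` has no solution, `668 ≡ 2 (mod 3)`).  Uses the tree's `PAF`, `IsPM`, `sq_rowsum`,
`paf_zero` (`Literature.Combinatorics.Designs.LegendrePairs`).  Ours, not literature; no `sorry`, no `native_decide`.
-/

open Finset BigOperators

namespace Summit.Ventures.DiscreteObjects.Hadamard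

open Literature.Combinatorics.Designs.LegendrePairs (PAF IsPM sq_rowsum paf_zero)

variable {n : ℕ} [NeZero n]

/-- A Goethals–Seidel quadruple on `ZMod n`: four `±1` sequences whose periodic autocorrelations sum to `0` at
every non-zero shift (⇔ `AAᵀ + BBᵀ + CCᵀ + DDᵀ = 4n·I` for the circulants ⇔ a supplementary difference family
`4-{n; k₁,k₂,k₃,k₄; Σkᵢ − n}`); plugged into the Goethals–Seidel array it gives a Hadamard matrix of order `4n`. -/
def GSQuad (a b c d : ZMod n → ℤ) : Prop :=
  IsPM a ∧ IsPM b ∧ IsPM c ∧ IsPM d ∧ ∀ s : ZMod n, s ≠ 0 → PAF a s + PAF b s + PAF c s + PAF d s = 0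

/-- PSD identity at frequency 0 for a GS quadruple: `(Σa)² + (Σb)² + (Σc)² + (Σd)² = 4n`. -/
theorem gs_rowsum_sq (a b c d : ZMod n → ℤ) (h : GSQuad a b c d) :
    (∑ i, a i) ^ 2 + (∑ i, b i) ^ 2 + (∑ i, c i) ^ 2 + (∑ i, d i) ^ 2 = 4 * n := by
  obtain ⟨ha, hb, hc, hd, hs⟩ := h
  rw [sq_rowsum, sq_rowsum, sq_rowsum, sq_rowsum, ← Finset.sum_add_distrib, ← Finset.sum_add_distrib,
    ← Finset.sum_add_distrib]
  have key : ∀ s : ZMod n, PAF a s + PAF b s + PAF c s + PAF d s = if s = 0 then 4 * (n : ℤ) else 0 := by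
    intro s; split_ifs with h0
    · subst h0; rw [paf_zero a ha, paf_zero b hb, paf_zero c hc, paf_zero d hd]; ring
    · exact hs s h0
  rw [Finset.sum_congr rfl (fun s _ => key s), Finset.sum_ite_eq']
  simp

/-- the row sum of a `±1` sequence has the parity of the length -/
theorem rowsum_parity (x : ZMod n → ℤ) (hx : IsPM x) : ∃ k : ℤ, ∑ i, x i = n + 2 * k := by
  have h1 : ∀ i, ∃ k : ℤ, x i = 1 + 2 * k := fun i => by
    rcases hx i with h | h
    · exact ⟨0, by rw [h]; ring⟩
    · exact ⟨-1, by rw [h]; ring⟩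
  choose k hk using h1
  refine ⟨∑ i, k i, ?_⟩
  rw [Finset.sum_congr rfl (fun i _ => hk i), Finset.sum_add_distrib, Finset.mul_sum]
  simp [ZMod.card]

/-- at odd length the row sum of a `±1` sequence is odd -/
theorem rowsum_odd (x : ZMod n → ℤ) (hx : IsPM x) (hn : Odd n) : Odd (∑ i, x i) := by
  obtain ⟨k, hk⟩ := rowsum_parity x hx
  obtain ⟨m, hm⟩ := hn
  rw [hk, hm]; push_cast
  exact ⟨m + k, by ring⟩

/-! ## `v = 167` -/

/-- the grammar at `v = 167`: the four row sums are odd and their squares sum to `668` -/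
theorem gs167_rowsums (a b c d : ZMod 167 → ℤ) (h : GSQuad a b c d) :
    (∑ i, a i) ^ 2 + (∑ i, b i) ^ 2 + (∑ i, c i) ^ 2 + (∑ i, d i) ^ 2 = 668 ∧
    Odd (∑ i, a i) ∧ Odd (∑ i, b i) ∧ Odd (∑ i, c i) ∧ Odd (∑ i, d i) := by
  have hodd : Odd (167 : ℕ) := ⟨83, by norm_num⟩
  refine ⟨?_, rowsum_odd a h.1 hodd, rowsum_odd b h.2.1 hodd, rowsum_odd c h.2.2.1 hodd,
    rowsum_odd d h.2.2.2.1 hodd⟩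
  have := gs_rowsum_sq a b c d h
  push_cast at this
  linarith

/-- odd squares are `1 mod 8`: `x² + y² = 334` has no solution in odd integers -/
lemma no_two_odd_squares_334 (x y : ℤ) (hx : Odd x) (hy : Odd y) : x ^ 2 + y ^ 2 ≠ 334 := by
  obtain ⟨p, rfl⟩ := hx
  obtain ⟨q, rfl⟩ := hy
  intro h
  have h8 : (((2 * p + 1) ^ 2 + (2 * q + 1) ^ 2) % 8) = (334 : ℤ) % 8 := by rw [h]
  have e1 : (2 * p + 1) ^ 2 = 4 * (p * (p + 1)) + 1 := by ring
  have e2 : (2 * q + 1) ^ 2 = 4 * (q * (q + 1)) + 1 := by ring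
  have hp : 2 ∣ p * (p + 1) := by
    rcases Int.even_or_odd p with ⟨r, hr⟩ | ⟨r, hr⟩
    · exact ⟨r * (p + 1), by rw [hr]; ring⟩
    · exact ⟨p * (r + 1), by rw [hr]; ring⟩
  have hq : 2 ∣ q * (q + 1) := by
    rcases Int.even_or_odd q with ⟨r, hr⟩ | ⟨r, hr⟩
    · exact ⟨r * (q + 1), by rw [hr]; ring⟩
    · exact ⟨q * (r + 1), by rw [hr]; ring⟩
  obtain ⟨u, hu⟩ := hp
  obtain ⟨w, hw⟩ := hq
  rw [e1, e2, hu, hw] at h8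
  omega

/-- `3x² + y² = 668` has no integer solution (`668 ≡ 2 (mod 3)` is not a square mod 3) -/
lemma no_three_one_668 (x y : ℤ) : 3 * x ^ 2 + y ^ 2 ≠ 668 := by
  intro h
  obtain ⟨k, r, hr0, hr3, rfl⟩ : ∃ k r : ℤ, 0 ≤ r ∧ r < 3 ∧ y = 3 * k + r :=
    ⟨y / 3, y % 3, Int.emod_nonneg _ (by norm_num), Int.emod_lt_of_pos _ (by norm_num), by omega⟩
  have hr : r = 0 ∨ r = 1 ∨ r = 2 := by omega
  rcases hr with rfl | rfl | rfl
  · have e : (3 * k + 0) ^ 2 = 3 * (3 * k ^ 2) := by ring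
    omega
  · have e : (3 * k + 1) ^ 2 = 3 * (3 * k ^ 2 + 2 * k) + 1 := by ring
    omega
  · have e : (3 * k + 2) ^ 2 = 3 * (3 * k ^ 2 + 4 * k + 1) + 1 := by ring
    omega

/-- **Degenerate coincidence (A, A, B, B) is empty at v = 167**: no GS quadruple with `a = b` and `c = d`
(then `2(Σa)² + 2(Σc)² = 668`, i.e. `(Σa)² + (Σc)² = 334`, impossible for odd row sums). -/
theorem no_gs167_pairs_equal (a c : ZMod 167 → ℤ) (h : GSQuad a a c c) : False := by
  obtain ⟨hsq, hoa, -, hoc, -⟩ := gs167_rowsums a a c c h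
  exact no_two_odd_squares_334 _ _ hoa hoc (by linarith)

/-- **Degenerate coincidence (A, A, A, B) is empty at v = 167**: no GS quadruple with `a = b = c`
(then `3(Σa)² + (Σd)² = 668 ≡ 2 (mod 3)`, impossible). -/
theorem no_gs167_three_equal (a d : ZMod 167 → ℤ) (h : GSQuad a a a d) : False := by
  obtain ⟨hsq, -, -, -, -⟩ := gs167_rowsums a a a d h
  exact no_three_one_668 (∑ i, a i) (∑ i, d i) (by linarith)

/-- the census row "GS with C₈₃-invariant blocks" restated with `GSQuad` (from `no_gs_quad_qr167`) -/
theorem no_gs167_qr_invariant (a b c d : ZMod 167 → ℤ) (h : GSQuad a b c d)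
    (ia : ∀ i, a (4 * i) = a i) (ib : ∀ i, b (4 * i) = b i) (ic : ∀ i, c (4 * i) = c i)
    (id : ∀ i, d (4 * i) = d i) : False :=
  no_gs_quad_qr167 a b c d h.1 h.2.1 h.2.2.1 h.2.2.2.1 ia ib ic id h.2.2.2.2

end Summit.Ventures.DiscreteObjects.Hadamard
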